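import Summits.QuantumFields.YangMills.Theorems.BalabanUVNodesN20BankedRecordPriceOfT4Branching

/-!
# N20 (NE7b), THE COUNT SIDE OF ROAD [e] AS ONE STATEMENT: ONE infrared threshold from the symbolic constants; then along EVERY run of the typed flow (2.5)∕(2.7)∕(2.9) past it, at EVERY
# cutoff, EVERY final-level stock whose candidates carry CONSISTENT, well-formed, pending, CHRONOLOGICAL genealogies of `pub-balaban`'s dictionary within the class ∕ fuel caps, with
# activities below their raw factors and at most `M^{partnerAges}` candidates per (slot, shape), obeys the two-rate budget `Σ x ≤ birthMass·e^{−κ₁}·V·(Λσ)^{K−j⋆+1}∕(1−Λσ)` — the shape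
# membership of `…OfT4Branching` §6 DISCHARGED by `T4CanonicalMenus.mem_canonFam_of_chrono`, the `Banking` by `T4PrintedShapeBanking.exists_irThreshold`

Cell `pub-ymgap`, YM-PLAN Track A (HUMAN RULING D-0062); seat `pub-ymgap-dag-n20-d` (R134 (a) N20 NE7b s3), gen 41 — inside director-ym №374 line (E) ∕ item (c); road [e] TOWER-FREE of
record (№377).  `--kind proof --supports stmt-QuantumFields-27366 --as helper` (K3⁸); COUNT-NEUTRAL; THEOREMS ONLY (0 `def`).  Companions BY NAME: `…N20BankedRecordPriceOfT4Branching.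
sum_stock_le_twoRate_of_canonicalLabels` (gen 41, p775581 ∕ v1.1 p775682) and `pub-balaban`'s `T4CanonicalMenus.{Chrono, fuel, canonFam, birthMass, mem_canonFam_of_chrono}`,
`T4TaggedShapeBanking.consistentT_id_iff`, `T4PrintedShapeBanking.exists_irThreshold`.

WHY.  The seat's memo `N20-R1-STRUCK.g41.md` (evidence on stmt-QuantumFields-27366) listed road [e]'s residue after (R1) was struck; `…OfT4Branching` made the count multiplicity-tolerant
and, over the canonical menus, discharged the menu data; two (ID) binders remained that `pub-balaban` also discharges: the SHAPE MEMBERSHIP `relabel shape (G Y) ∈ canonFam Dcap Ncap K j`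
— by `T4CanonicalMenus.mem_canonFam_of_chrono` it follows from consistency + CHRONOLOGY (`Chrono`: the time order in which the count builds its terms — renewals after the line's root and
not before its events, mergers older line first) + the class cap `fat < Dcap K` on births + the fuel cap `fuel ≤ Ncap K` — and the `Banking`, by `exists_irThreshold`.  THIS FILE composes
them: §1 `sum_stock_le_twoRate_of_chronoLabels` (the budget of `…canonicalLabels` with `hfam` replaced by chronology + caps + `rootStep = slot.1`); §2 ★★★
`exists_irThreshold_stockBudget_chrono` — the COUNT SIDE OF ROAD [e] END TO END: ONE `x₀` from the constants, then for every cutoff `K`, run `(R, g, β′)` obeying `B14.FlowIneq27`,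
`B14FlowStep.FlowIneq29`, `B14.IsRj`, `1 ≤ log g_s⁻²`, `x₀ ≤ log g_K⁻²`, nonnegative profile, every cap datum `Dcap, Ncap`, every so-labelled stock: the budget.  What it displays is
exactly the census of what is NOT kernel on the count side of road [e]: the labelling (consistent ∕ well-formed ∕ pending ∕ chronological genealogies with activities below raw
factors — (b) + the one analytic wall (a) in the factor clause of the letter that CONSUMES this budget, `…OfT4Branching` §5), the fibre multiplicity `M^{partnerAges}` (partners' birth
cells) and the caps ((ID)), ONE numeric side condition and the root rate (entropy numerics), the cells, the typed flow + infrared smallness ((B)).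

WHAT IS PROVED (kernel; compositions BY NAME; zero `sorry`).  §1 ★★ `sum_stock_le_twoRate_of_chronoLabels`.  §2 ★★★ `exists_irThreshold_stockBudget_chrono`.

HONEST FRAMING.  [bookkeeping]: two compositions; no estimate.  NOTHING of Bałaban's is asserted; the typed displays (2.5)∕(2.7)∕(2.9) are HYPOTHESES; the identification of
`T4PrintedShapeBanking.Consts`, the dictionary's events, windows and caps with print's objects is READING (ID) (`pub-balaban`'s, located there); NE7 ∕ NE7b ∕ NE7c NOT PRINTED for `d = 4`
∕ NOT proved; no `Provisos` inhabitant claimed; K3⁸ untouched; N20 NOT discharged; counts UNMOVED (typed 28∕28 · discharged 8∕27); one finite four-torus programme at fixed `ε` — NOT ℝ⁴,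
NOT OS, NOT a mass gap, NOT the Clay problem.  No `def`, no `instance`, no `notation`, no `sorry`; no decl below carries a cite tag.
-/

noncomputable section

open Finset
open scoped BigOperators

namespace YMDAG.UVSplit

open Literature.MathematicalPhysics.QuantumFieldTheory.Balaban1983to89
open T4PersistenceDictionary (Gen PEv dictW)
open T4BankedInduction (Banking credits lifeCost)
open T4PartnerMultiplicity (partnerAges)
open T4BranchingRecordsGas (relabel shape)
open T4PrintedShapeBanking (Consistent exists_irThreshold)
open T4TaggedShapeBanking (consistentT_id_iff)
open T4CanonicalMenus (Chrono fuel canonFam birthMass mem_canonFam_of_chrono)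

/-! ## §1 Chronological labels: the shape membership discharged -/

section ChronoLabels

variable {X γ : Type*} [DecidableEq γ]

/-- ★★ **THE STOCK BUDGET OVER THE CANONICAL MENUS FOR CHRONOLOGICALLY LABELLED STOCKS** (`…OfT4Branching.sum_stock_le_twoRate_of_canonicalLabels` with its shape-membership binder
`hfam` DISCHARGED by `T4CanonicalMenus.mem_canonFam_of_chrono` + `T4TaggedShapeBanking.consistentT_id_iff`): a printed-shape `Banking` at cutoff `K`, candidates filed under birth slots and
labelled by CONSISTENT, well-formed, pending, CHRONOLOGICAL genealogies `G Y : Gen PEv` rooted at the slot's step, births within the class cap `fat < Dcap K`, fuel `≤ Ncap K`, activities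
below raw factors, fibre multiplicities `≤ M^{partnerAges}`, the age datum with its one side condition, root rate, nonnegative profile ⇒ the two-rate budget with `ρ̄ = birthMass C`,
`σ = e^{η̄₊−κ₁}`. [bookkeeping] -/
theorem sum_stock_le_twoRate_of_chronoLabels (C : T4PrintedShapeBanking.Consts) (hκ : 0 ≤ C.κ₁) (hμ₀ : 0 < C.μ) {K : ℕ} {R : ℕ → ℕ} {g : ℕ → ℝ}
    (B : Banking (Consistent C K R) (dictW R C.n₁) (T4PrintedShapeBanking.cost C K R) (T4PrintedShapeBanking.credit C g)
      (fun e => C.κ₁ * ((dictW R C.n₁ e : ℕ) : ℝ) + T4PrintedShapeBanking.Emarg C e) (T4PrintedShapeBanking.reserve C g) (T4PrintedShapeBanking.extn C K R))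
    (hP : ∀ j, 0 ≤ p0Profile C.A₀ C.p₀ (g j)) (Dcap Ncap : ℕ → ℕ)
    (Old : Finset X) (slot : X → (Σ _ : ℕ, γ)) (G : X → Gen PEv) (x : X → ℝ)
    (Cell : ℕ → Finset γ) {V Λ : ℝ} (hV : 0 ≤ V) (hΛ : 0 ≤ Λ) (hcell : ∀ a, ((Cell a).card : ℝ) ≤ V * Λ ^ a)
    {M ηplus : ℝ} (hM : 0 ≤ M) (hηplus : 0 ≤ ηplus) (h1 : M * Real.exp (-C.κ₁) * Real.exp ηplus < 1)
    (hside : (Real.exp (-C.E₀) + Real.exp (-C.E₀) * birthMass C * (M * Real.exp (-C.κ₁) / (1 - M * Real.exp (-C.κ₁) * Real.exp ηplus))) * Real.exp ηplus ≤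
      Real.exp ηplus - 1)
    (hr : Λ * Real.exp (ηplus - C.κ₁) < 1) {jstar : ℕ} (hj : jstar ≤ K)
    (hold : ∀ Y ∈ Old, (slot Y).1 < jstar) (hmem : ∀ Y ∈ Old, (slot Y).2 ∈ Cell (K - (slot Y).1))
    (hcon : ∀ Y ∈ Old, Consistent C K R (G Y)) (hwf : ∀ Y ∈ Old, (G Y).WF (dictW R C.n₁)) (hpend : ∀ Y ∈ Old, K < (G Y).reach (dictW R C.n₁))
    (hchrono : ∀ Y ∈ Old, Chrono PEv.step (G Y)) (hfat : ∀ Y ∈ Old, ∀ e ∈ (G Y).events, e.kind = 0 → e.fat < Dcap K) (hfuel : ∀ Y ∈ Old, fuel (G Y) ≤ Ncap K)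
    (hroot : ∀ Y ∈ Old, (G Y).rootStep = (slot Y).1)
    (hx : ∀ Y ∈ Old, x Y ≤ Real.exp (-credits (T4PrintedShapeBanking.credit C g) (G Y)) * Real.exp (lifeCost (dictW R C.n₁) (T4PrintedShapeBanking.cost C K R) (G Y)))
    (hcard : ∀ j < jstar, ∀ z ∈ Cell (K - j), ∀ G₀ ∈ canonFam Dcap Ncap K j,
      (((Old.filter fun Y => slot Y = ⟨j, z⟩ ∧ relabel shape (G Y) = G₀).card : ℕ) : ℝ) ≤ M ^ partnerAges PEv.step G₀) :
    ∑ Y ∈ Old, x Y ≤ birthMass C * Real.exp (-C.κ₁) * V * ((Λ * Real.exp (ηplus - C.κ₁)) ^ (K - jstar + 1) / (1 - Λ * Real.exp (ηplus - C.κ₁))) := by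
  refine sum_stock_le_twoRate_of_canonicalLabels C hκ hμ₀ B hP Dcap Ncap Old slot G x Cell hV hΛ hcell hM hηplus h1 hside hr hj hold hmem hcon hwf hpend (fun Y hY => ?_) hx hcard
  have hc : T4TaggedShapeBanking.ConsistentT (id : PEv → PEv) C K R (G Y) := (consistentT_id_iff C K R (G Y)).2 (hcon Y hY)
  have h := mem_canonFam_of_chrono (sh := (id : PEv → PEv)) (Dcap := Dcap) (Ncap := Ncap) hc (hchrono Y hY) (fun e he hk => hfat Y hY e he hk) (hfuel Y hY)
  rwa [Function.comp_id, hroot Y hY] at h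

end ChronoLabels

/-! ## §2 The count side of road [e], end to end: ONE infrared threshold, then every cutoff, run and labelled stock -/

section EndToEnd

variable {X γ : Type*} [DecidableEq γ]

/-- ★★★ **THE COUNT SIDE OF ROAD [e] AS ONE STATEMENT** (`T4PrintedShapeBanking.exists_irThreshold` ∘ §1): for valid symbolic constants with `a, A₀, μ > 0`, `L ≥ 1`, `β₀ ≥ 0`,
`r(q′+1) < p₀` there is ONE number `x₀` (constants only) such that for EVERY cutoff `K` and run `(R, g, β′)` obeying the typed (2.7) `B14.FlowIneq27`, (2.9) `B14FlowStep.FlowIneq29`,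
(2.5) `B14.IsRj`, `1 ≤ log g_s⁻²` (`s ≤ K`), the infrared smallness `x₀ ≤ log g_K⁻²` and a nonnegative profile, for EVERY cap datum `Dcap, Ncap` and EVERY final-level stock filed under
birth slots (old: `< j⋆ ≤ K`, cells `#Cell a ≤ V·Λ^a`) whose candidates carry consistent, well-formed, pending, chronological genealogies rooted at their slots within the caps, with
activities below their raw factors and at most `M^{partnerAges}` candidates per (slot, shape), under the age datum `M·e^{−κ₁}·e^{η̄₊} < 1` with its one side condition and the root rate
`Λ·e^{η̄₊−κ₁} < 1`: `Σ_{Y ∈ Old} x Y ≤ birthMass C·e^{−κ₁}·V·(Λσ)^{K − j⋆ + 1}∕(1 − Λσ)`, `σ = e^{η̄₊−κ₁}`.  Its binders are the census of what is not kernel on the count side of road [e].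
[bookkeeping] -/
theorem exists_irThreshold_stockBudget_chrono (C : T4PrintedShapeBanking.Consts) (hC : C.Valid) (ha : 0 < C.a) (hA : 0 < C.A₀) (hμ₀ : 0 < C.μ) {L r : ℕ} (hL : 1 ≤ L)
    {β₀ : ℝ} (hβ : 0 ≤ β₀) (hrq : r * (C.q' + 1) < C.p₀) :
    ∃ x₀ : ℝ, ∀ (K : ℕ) (R : ℕ → ℕ) (g : ℕ → ℝ) (β' : ℝ),
      B14.FlowIneq27 g β' β₀ C.p₀ K → B14FlowStep.FlowIneq29 R g L β' β₀ K →
      (∀ s, s ≤ K → B14.IsRj L r (g s) (R s)) → (∀ s, s ≤ K → 1 ≤ Real.log ((g s) ^ 2)⁻¹) → x₀ ≤ Real.log ((g K) ^ 2)⁻¹ →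
      (∀ j, 0 ≤ p0Profile C.A₀ C.p₀ (g j)) →
      ∀ (Dcap Ncap : ℕ → ℕ) (Old : Finset X) (slot : X → (Σ _ : ℕ, γ)) (G : X → Gen PEv) (x : X → ℝ) (Cell : ℕ → Finset γ) (V Λ : ℝ),
        0 ≤ V → 0 ≤ Λ → (∀ a, ((Cell a).card : ℝ) ≤ V * Λ ^ a) →
      ∀ (M ηplus : ℝ), 0 ≤ M → 0 ≤ ηplus → M * Real.exp (-C.κ₁) * Real.exp ηplus < 1 →
        (Real.exp (-C.E₀) + Real.exp (-C.E₀) * birthMass C * (M * Real.exp (-C.κ₁) / (1 - M * Real.exp (-C.κ₁) * Real.exp ηplus))) * Real.exp ηplus ≤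
          Real.exp ηplus - 1 →
        Λ * Real.exp (ηplus - C.κ₁) < 1 →
      ∀ (jstar : ℕ), jstar ≤ K → (∀ Y ∈ Old, (slot Y).1 < jstar) → (∀ Y ∈ Old, (slot Y).2 ∈ Cell (K - (slot Y).1)) →
        (∀ Y ∈ Old, Consistent C K R (G Y)) → (∀ Y ∈ Old, (G Y).WF (dictW R C.n₁)) → (∀ Y ∈ Old, K < (G Y).reach (dictW R C.n₁)) →
        (∀ Y ∈ Old, Chrono PEv.step (G Y)) → (∀ Y ∈ Old, ∀ e ∈ (G Y).events, e.kind = 0 → e.fat < Dcap K) → (∀ Y ∈ Old, fuel (G Y) ≤ Ncap K) →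
        (∀ Y ∈ Old, (G Y).rootStep = (slot Y).1) →
        (∀ Y ∈ Old, x Y ≤ Real.exp (-credits (T4PrintedShapeBanking.credit C g) (G Y)) * Real.exp (lifeCost (dictW R C.n₁) (T4PrintedShapeBanking.cost C K R) (G Y))) →
        (∀ j < jstar, ∀ z ∈ Cell (K - j), ∀ G₀ ∈ canonFam Dcap Ncap K j,
          (((Old.filter fun Y => slot Y = ⟨j, z⟩ ∧ relabel shape (G Y) = G₀).card : ℕ) : ℝ) ≤ M ^ partnerAges PEv.step G₀) →
      ∑ Y ∈ Old, x Y ≤ birthMass C * Real.exp (-C.κ₁) * V * ((Λ * Real.exp (ηplus - C.κ₁)) ^ (K - jstar + 1) / (1 - Λ * Real.exp (ηplus - C.κ₁))) := by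
  obtain ⟨x₀, hx₀⟩ := exists_irThreshold C hC ha hA hL hβ hrq
  refine ⟨x₀, ?_⟩
  intro K R g β' h27 h29 hR hx1 hxK hP Dcap Ncap Old slot G x Cell V Λ hV hΛ hcell M ηplus hM hηplus h1 hside hr jstar hj hold hmem hcon hwf hpend hchrono hfat hfuel hroot
    hx hcard
  exact sum_stock_le_twoRate_of_chronoLabels C hC.κ₁_nonneg hμ₀ (hx₀ K R g β' h27 h29 hR hx1 hxK) hP Dcap Ncap Old slot G x Cell hV hΛ hcell hM hηplus h1 hside hr hj hold hmem
    hcon hwf hpend hchrono hfat hfuel hroot hx hcard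

end EndToEnd

end YMDAG.UVSplit
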